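import Summits.CriticalPhenomena.PercolationContinuityZ3.Theorems.PercNearOneGluingNoHeavyQuantIndepBlobCloudComponents
import HarnessLib

/-!
# QUANT lane R8, Conjecture DIB\* — the CLAMP certificate: every outcome of the light cloud carried by a HEAVY component
# (the truncated-mean condition `E[min(Λ, Cp/x)] > Cp` with its floor, memo §10), every floor `0 < x < 1`

builds on p205010 (kernel theorem, internal audit signed; external expert review pending)

Support file (`--supports stmt-CriticalPhenomena-4575`), QUANT lane census seat prim-quant-census-1 (gen 15), rung R8 of
`run/shared/lean/prim/quant/LADDER.md`; memo `run/shared/lean/prim/quant/prim-quant-census-1/SMALL-CLOUD-G15.md` §10.  Part (IV) of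
`…QuantIndepBlobCloudComponents` / `…SmallCloud` / `…BigLights`.  Theorems only, no definitions, no sorries, standard axioms.

SETTING (as in parts I–III).  Blobs `k : κ`, sizes `a k`, gates `p k ∈ [0,1]`, floor `x`; a cloud `L`, the other blobs heavy (`x ≤ p k`);
`C_H = Σ_{k ∉ L} a k·p k`, SHORTFALL `Cp = 2j − C_H`; cloud weights `w_L(S)`, `m₀ = w_L(∅)`; heavy restricted tail `TL`.

THE CLAMP CERTIFICATE.  In the regime 'every light bigger than half the shortfall' (`2·a_k > Cp`, so only the empty outcome is deficient)
every non-empty outcome `S` is carried by the HEAVY component `(0, a(S), γ)` with `γ = max(x, Cp/a(S))⁺`, worth `1/γ − 1 = min((1−x)/x, (a(S) − Cp)/Cp)`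
units of empty mass per unit of its own mass (and `0` if `a(S) ≤ Cp`).  So the explicit finite inequality
`x·Cp·m₀ < Σ_{S} w_L(S)·max(0, min(x(a(S) − Cp), (1 − x)Cp))` certifies the row (memo §10.1: it is the TRUNCATED-MEAN condition
`E[min(Λ, Cp/x)] > Cp` with the floor `1` restored on the outcomes `a(S) ≤ Cp`; with the light routes of the big singletons added it held on every
one of 15 928 sampled only-empty-deficient corner clouds).

* `Quant.IndepBlob.tail_ge_of_clampCert` — **the CLAMP certificate ⟹ `x ≤ P(N ≥ j+1)`** (no size or gate hypothesis on the cloud).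
Part (V) `…QuantIndepBlobTwoMediumLights` discharges the certificate for two medium lights by an identity.

[this work; this lane's census]; the gluing rows served: [cite: KozmaNitzan2024, Conjecture 3 (p. 15)]; product weights
[cite: Grimmett1999, §1.3 p. 10].
-/

namespace Summit.CriticalPhenomena.PercolationContinuityZ3.Theorems

namespace Quant

namespace IndepBlob

open Finset

variable {κ : Type*} [Fintype κ] [DecidableEq κ]

/-! ### 8. The clamp certificate -/

/-- **THE CLAMP CERTIFICATE.**  Gates in `[0,1]`, floor `0 < x < 1`, a cloud `L` off which every blob is heavy, every light `k ∈ L` with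
`2j < C_H + 2·a_k`, and `x·Cp·m₀ < Σ_{S ⊆ L} w_L(S)·max(0, min(x(a(S) − Cp), (1 − x)Cp))` (`Cp = 2j − C_H`, `m₀ = Π_L (1 − p_k)`)
⟹ `x ≤ P(N ≥ j+1)`. [this work] -/
theorem tail_ge_of_clampCert (p : κ → ℝ) (a : κ → ℕ) (x : ℝ) (hx0 : 0 < x) (hx1 : x < 1)
    (hp0 : ∀ k, 0 ≤ p k) (hp1 : ∀ k, p k ≤ 1) (L : Finset κ) (hheavy : ∀ k, k ∉ L → x ≤ p k) (j : ℕ)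
    (hmid : ∀ k ∈ L, (2 * j : ℝ) < (∑ i ∈ Finset.univ \ L, (a i : ℝ) * p i) + 2 * (a k : ℝ))
    (hclamp : x * (2 * j - ∑ i ∈ Finset.univ \ L, (a i : ℝ) * p i) * ∏ k ∈ L, (1 - p k) <
      ∑ S ∈ L.powerset, (∏ k ∈ L, if k ∈ S then p k else 1 - p k) *
        max 0 (min (x * ((∑ k ∈ S, a k : ℕ) - (2 * j - ∑ i ∈ Finset.univ \ L, (a i : ℝ) * p i)))
          ((1 - x) * (2 * j - ∑ i ∈ Finset.univ \ L, (a i : ℝ) * p i)))) :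
    x ≤ ∑ s : Finset κ, (∏ k, if k ∈ s then p k else 1 - p k) * (if j + 1 ≤ ∑ k ∈ s, a k then (1 : ℝ) else 0) := by
  have h1x : 0 < 1 - x := by linarith
  set U : Finset κ := Finset.univ \ L with hU
  set CH : ℝ := ∑ i ∈ U, (a i : ℝ) * p i with hCH
  set Cp : ℝ := 2 * j - CH with hCp
  set TL : ℕ → ℝ := fun t => ∑ T ∈ U.powerset, (∏ k ∈ U, if k ∈ T then p k else 1 - p k) *
      (if t ≤ ∑ k ∈ T, a k then (1 : ℝ) else 0) with hTL
  set wL : Finset κ → ℝ := fun S => ∏ k ∈ L, if k ∈ S then p k else 1 - p k with hwL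
  set φ : Finset κ → ℝ := fun S => max 0 (min (x * ((∑ k ∈ S, a k : ℕ) - Cp)) ((1 - x) * Cp)) with hφ
  have hwL0 : ∀ S, 0 ≤ wL S := fun S => weightU_nonneg p L (fun k _ => hp0 k) (fun k _ => hp1 k) S
  have hφ0 : ∀ S, 0 ≤ φ S := fun S => le_max_left _ _
  have hTLnn : ∀ t, 0 ≤ TL t := fun t => tailU_nonneg p a U (fun k _ => hp0 k) (fun k _ => hp1 k) t
  have hTL0 : TL 0 = 1 := tailU_zero p a U
  have hTLanti : ∀ {t t' : ℕ}, t ≤ t' → TL t' ≤ TL t := fun htt =>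
    tailU_antitone p a U (fun k _ => hp0 k) (fun k _ => hp1 k) htt
  have hm0 : wL ∅ = ∏ k ∈ L, (1 - p k) := Finset.prod_congr rfl fun k _ => by rw [if_neg (Finset.notMem_empty k)]
  have hm0nn : 0 ≤ wL ∅ := hwL0 ∅
  change x * Cp * ∏ k ∈ L, (1 - p k) < ∑ S ∈ L.powerset, wL S * φ S at hclamp
  rw [← hm0] at hclamp
  -- cloud conditioning
  rw [tail_cloud_split p a L (j + 1)]
  change x ≤ ∑ S ∈ L.powerset, wL S * TL (j + 1 - ∑ k ∈ S, a k)
  by_cases hTLx : x ≤ TL (j + 1)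
  · calc x = ∑ S ∈ L.powerset, wL S * x := by rw [← Finset.sum_mul, sum_powerset_weight p L, one_mul]
      _ ≤ ∑ S ∈ L.powerset, wL S * TL (j + 1 - ∑ k ∈ S, a k) :=
          Finset.sum_le_sum fun S _ => mul_le_mul_of_nonneg_left (hTLx.trans (hTLanti (Nat.sub_le _ _))) (hwL0 S)
  push Not at hTLx
  -- the cloud is non-empty and the shortfall is positive
  have hφ_nonpos : Cp ≤ 0 → ∀ S, φ S = 0 := by
    intro hC S
    have : min (x * ((∑ k ∈ S, a k : ℕ) - Cp)) ((1 - x) * Cp) ≤ 0 :=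
      (min_le_right _ _).trans (mul_nonpos_of_nonneg_of_nonpos h1x.le hC)
    exact le_antisymm (max_le le_rfl this) (le_max_left _ _)
  rcases L.eq_empty_or_nonempty with hL0 | ⟨ℓ₀, hℓ₀⟩
  · exfalso
    -- with an empty cloud the certificate forces `Cp < 0`, and then the heavy row reaches `x`
    have hU0 : U = Finset.univ := by rw [hU, hL0, Finset.sdiff_empty]
    have hCpneg : Cp < 0 := by
      by_contra h
      push Not at h
      rw [hL0, Finset.powerset_empty, Finset.sum_singleton] at hclamp
      have hφe : φ ∅ ≤ 0 := by
        have : min (x * ((∑ k ∈ (∅ : Finset κ), a k : ℕ) - Cp)) ((1 - x) * Cp) ≤ 0 := by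
          rw [Finset.sum_empty, Nat.cast_zero, zero_sub]
          exact (min_le_left _ _).trans (by nlinarith)
        exact max_le le_rfl this
      have h1 : wL ∅ = 1 := by rw [hm0, hL0, Finset.prod_empty]
      rw [h1] at hclamp
      nlinarith
    have hbudget : (2 * j : ℝ) < 2 * ((0 : ℕ) : ℝ) + ∑ k, (a k : ℝ) * p k := by
      rw [Nat.cast_zero, mul_zero, zero_add, ← hU0]; rw [hCp] at hCpneg; linarith
    have hfloor : ∀ k, a k ≠ 0 → x ≤ p k := fun k _ => hheavy k (by rw [hL0]; exact Finset.notMem_empty k)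
    have key := RootDec.term_ge_of_budget 0 a p j x hx1.le (fun k => ⟨hp0 k, hp1 k⟩) hfloor hbudget
    simp only [zero_add] at key
    have e : TL (j + 1) = ∑ W : Finset κ, (∏ k, if k ∈ W then p k else 1 - p k) * (if j + 1 ≤ ∑ k ∈ W, a k then (1 : ℝ) else 0) := by
      simp only [hTL, hU0]
      exact tailU_univ p a (j + 1)
    rw [← e] at key
    linarith
  have hCp0 : 0 < Cp := by
    by_contra h
    push Not at h
    rcases h.lt_or_eq with hlt | heq
    · -- negative shortfall: the heavies alone reach `x`
      have key := cloud_component_row p a x hx0 hx1 hp0 hp1 L ℓ₀ hℓ₀ hheavy j 0 0 0 le_rfl zero_le_one le_rfl (Nat.zero_le _)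
        (by simp only [Nat.sub_self, Nat.cast_zero, zero_mul, mul_zero, add_zero]; rw [hCp] at hlt; linarith)
      rw [Nat.sub_zero, zero_mul, sub_zero, one_mul, zero_add] at key
      linarith
    · have hz : ∑ S ∈ L.powerset, wL S * φ S = 0 :=
        Finset.sum_eq_zero fun S _ => by rw [hφ_nonpos heq.le S, mul_zero]
      rw [hz, heq] at hclamp
      linarith [hm0nn]
  have hφ_empty : φ ∅ = 0 := by
    have : min (x * ((∑ k ∈ (∅ : Finset κ), a k : ℕ) - Cp)) ((1 - x) * Cp) ≤ 0 := by
      rw [Finset.sum_empty, Nat.cast_zero, zero_sub]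
      exact (min_le_left _ _).trans (mul_nonpos_of_nonneg_of_nonpos hx0.le (by linarith))
    exact le_antisymm (max_le le_rfl this) (le_max_left _ _)
  -- every non-empty light outcome is certified by its sure mass
  have hsure : ∀ S ∈ L.powerset, S ≠ ∅ → x ≤ TL (j + 1 - ∑ k ∈ S, a k) := by
    intro S hS hne
    have hSL : S ⊆ L := Finset.mem_powerset.1 hS
    obtain ⟨k, hk⟩ := Finset.nonempty_iff_ne_empty.2 hne
    have hak : a k ≤ ∑ i ∈ S, a i := Finset.single_le_sum (fun i _ => Nat.zero_le _) hk
    by_cases hbig : j + 1 ≤ ∑ i ∈ S, a i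
    · have e : j + 1 - ∑ i ∈ S, a i = 0 := by omega
      rw [e, hTL0]; exact hx1.le
    · have hle : ∑ i ∈ S, a i ≤ j := by omega
      have hcr : (2 * j : ℝ) < CH + 2 * ((∑ i ∈ S, a i : ℕ) : ℝ) +
          ((∑ i ∈ S, a i - ∑ i ∈ S, a i : ℕ) : ℝ) * (if x ≤ (0 : ℝ) then (0 : ℝ) else (0 - x ^ 2) / (1 - x)) := by
        rw [Nat.sub_self, Nat.cast_zero, zero_mul, add_zero]
        have h1 := hmid k (hSL hk)
        have h2 : ((a k : ℕ) : ℝ) ≤ ((∑ i ∈ S, a i : ℕ) : ℝ) := Nat.cast_le.2 hak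
        linarith
      have key := cloud_component_row p a x hx0 hx1 hp0 hp1 L ℓ₀ hℓ₀ hheavy j (∑ i ∈ S, a i) (∑ i ∈ S, a i) 0 le_rfl
        zero_le_one le_rfl hle hcr
      rw [zero_mul, zero_add, sub_zero, one_mul] at key
      exact key
  -- the certificate's slack, and the fraction `θ < 1` of it that is spent
  set RHS : ℝ := ∑ S ∈ L.powerset, wL S * φ S with hRHS
  set LHS : ℝ := x * Cp * wL ∅ with hLHS
  have hLHS0 : 0 ≤ LHS := mul_nonneg (mul_nonneg hx0.le hCp0.le) hm0nn
  have hRHSpos : 0 < RHS := lt_of_le_of_lt hLHS0 hclamp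
  set θ : ℝ := (LHS + (RHS - LHS) / 2) / RHS with hθ
  have hθ1 : θ < 1 := by rw [hθ, div_lt_one hRHSpos]; linarith
  have hθ0 : 0 ≤ θ := div_nonneg (by linarith) hRHSpos.le
  have hθRHS : θ * RHS = LHS + (RHS - LHS) / 2 := by rw [hθ]; field_simp
  -- the rate of outcome `S`: `κ_S = φ S / (x Cp)`, and the payment inequality
  set κr : Finset κ → ℝ := fun S => φ S / (x * Cp) with hκr
  have hxCp : 0 < x * Cp := mul_pos hx0 hCp0
  have hκ0 : ∀ S, 0 ≤ κr S := fun S => div_nonneg (hφ0 S) hxCp.le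
  have hκle : ∀ S, κr S ≤ (1 - x) / x := by
    intro S
    show φ S / (x * Cp) ≤ (1 - x) / x
    rw [div_le_div_iff₀ hxCp hx0]
    have : φ S ≤ (1 - x) * Cp := max_le (mul_nonneg h1x.le hCp0.le) (min_le_right _ _)
    nlinarith
  have hpay : ∀ S ∈ L.powerset, wL S * (θ * κr S * (x - TL (j + 1))) - (if S = ∅ then wL ∅ * (x - TL (j + 1)) else 0) ≤
      wL S * (TL (j + 1 - ∑ k ∈ S, a k) - x) := by
    intro S hS
    by_cases hS0 : S = ∅
    · subst hS0
      have hφS : φ ∅ = 0 := hφ_empty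
      have hκS : κr ∅ = 0 := by show φ ∅ / (x * Cp) = 0; rw [hφS, zero_div]
      rw [hκS, if_pos rfl, Finset.sum_empty, Nat.sub_zero]; ring_nf; rfl
    rw [if_neg hS0, sub_zero]
    refine mul_le_mul_of_nonneg_left ?_ (hwL0 S)
    by_cases haC : ((∑ k ∈ S, a k : ℕ) : ℝ) ≤ Cp
    · -- no rate; the outcome is sure-certified
      have hφS : φ S = 0 := by
        have : min (x * ((∑ k ∈ S, a k : ℕ) - Cp)) ((1 - x) * Cp) ≤ 0 :=
          (min_le_left _ _).trans (mul_nonpos_of_nonneg_of_nonpos hx0.le (by linarith))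
        exact le_antisymm (max_le le_rfl this) (le_max_left _ _)
      have hκS : κr S = 0 := by show φ S / (x * Cp) = 0; rw [hφS, zero_div]
      rw [hκS, mul_zero, zero_mul]
      linarith [hsure S hS hS0]
    · push Not at haC
      -- the heavy component `(0, a(S), γ)` with `1/γ = 1 + θ κ_S`
      have hκpos : 0 < κr S := by
        have hφpos : 0 < φ S := by
          have : 0 < min (x * ((∑ k ∈ S, a k : ℕ) - Cp)) ((1 - x) * Cp) :=
            lt_min (mul_pos hx0 (sub_pos.2 haC)) (mul_pos h1x hCp0)
          exact lt_of_lt_of_le this (le_max_right _ _)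
        exact div_pos hφpos hxCp
      have hθκ0 : 0 ≤ θ * κr S := mul_nonneg hθ0 (hκ0 S)
      have hθκ1 : θ * κr S ≤ (1 - x) / x := (mul_le_of_le_one_left (hκ0 S) hθ1.le).trans (hκle S)
      set γ : ℝ := 1 / (1 + θ * κr S) with hγ
      have hden : 0 < 1 + θ * κr S := by linarith
      have hγpos : 0 < γ := div_pos one_pos hden
      have hγ1 : γ ≤ 1 := by rw [hγ, div_le_one hden]; linarith
      have hγx : x ≤ γ := by
        rw [hγ, le_div_iff₀ hden]
        have h3 : x * ((1 - x) / x) = 1 - x := by field_simp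
        have h4 : x * (θ * κr S) ≤ x * ((1 - x) / x) := mul_le_mul_of_nonneg_left hθκ1 hx0.le
        rw [h3] at h4
        linarith
      have hinv : (1 - γ) / γ = θ * κr S := by
        rw [hγ]; field_simp; ring
      -- credit: `a(S)·γ > Cp` because `θ κ_S < (a(S) − Cp)/Cp`
      have hcredit : Cp < ((∑ k ∈ S, a k : ℕ) : ℝ) * γ := by
        rw [hγ, mul_one_div, lt_div_iff₀ hden]
        have h1 : κr S ≤ (((∑ k ∈ S, a k : ℕ) : ℝ) - Cp) / Cp := by
          show φ S / (x * Cp) ≤ (((∑ k ∈ S, a k : ℕ) : ℝ) - Cp) / Cp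
          rw [div_le_div_iff₀ hxCp hCp0]
          have : φ S ≤ x * (((∑ k ∈ S, a k : ℕ) : ℝ) - Cp) := max_le (by nlinarith) (min_le_left _ _)
          nlinarith
        have h2 : θ * κr S < (((∑ k ∈ S, a k : ℕ) : ℝ) - Cp) / Cp := by
          have : θ * κr S < 1 * κr S := mul_lt_mul_of_pos_right hθ1 hκpos
          linarith
        have h3 : Cp * ((((∑ k ∈ S, a k : ℕ) : ℝ) - Cp) / Cp) = ((∑ k ∈ S, a k : ℕ) : ℝ) - Cp := by field_simp
        have h4 : Cp * (θ * κr S) < Cp * ((((∑ k ∈ S, a k : ℕ) : ℝ) - Cp) / Cp) := mul_lt_mul_of_pos_left h2 hCp0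
        rw [h3] at h4
        linarith
      by_cases hgiant : j + 1 ≤ ∑ k ∈ S, a k
      · -- a heavy giant: pays `1 − x ≥ κ_S·x ≥ θ κ_S (x − TL(j+1))`
        have e : j + 1 - ∑ k ∈ S, a k = 0 := by omega
        rw [e, hTL0]
        have h2 : x - TL (j + 1) ≤ x := by linarith [hTLnn (j + 1)]
        have h3 : θ * κr S * (x - TL (j + 1)) ≤ (1 - x) / x * x :=
          mul_le_mul hθκ1 h2 (by linarith) (div_nonneg h1x.le hx0.le)
        have h4 : (1 - x) / x * x = 1 - x := by field_simp
        linarith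
      · have hle : ∑ k ∈ S, a k ≤ j := by omega
        have hcr : (2 * j : ℝ) < CH + 2 * ((0 : ℕ) : ℝ) +
            ((∑ k ∈ S, a k - 0 : ℕ) : ℝ) * (if x ≤ γ then γ else (γ - x ^ 2) / (1 - x)) := by
          rw [if_pos hγx, Nat.sub_zero, Nat.cast_zero, mul_zero, add_zero]
          rw [hCp] at hcredit; linarith
        have key := cloud_component_row p a x hx0 hx1 hp0 hp1 L ℓ₀ hℓ₀ hheavy j 0 (∑ k ∈ S, a k) γ hγpos.le hγ1
          (Nat.zero_le _) hle hcr
        rw [Nat.sub_zero] at key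
        -- `x ≤ γ T_S + (1 − γ) T₀` ⟹ `T_S − x ≥ (1−γ)/γ (x − T₀) = θ κ_S (x − T₀)`
        rw [← hinv]
        have h1 : γ * (TL (j + 1 - ∑ k ∈ S, a k) - x) ≥ (1 - γ) * (x - TL (j + 1)) := by linarith
        rw [ge_iff_le, ← div_le_iff₀' hγpos] at h1
        calc (1 - γ) / γ * (x - TL (j + 1)) = (1 - γ) * (x - TL (j + 1)) / γ := by ring
          _ ≤ TL (j + 1 - ∑ k ∈ S, a k) - x := h1
  -- summing the payments
  have hsum := Finset.sum_le_sum hpay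
  rw [Finset.sum_sub_distrib, Finset.sum_ite_eq' L.powerset (∅ : Finset κ), if_pos (Finset.empty_mem_powerset L)] at hsum
  have e1 : ∑ S ∈ L.powerset, wL S * (θ * κr S * (x - TL (j + 1))) = θ * (x - TL (j + 1)) * (RHS / (x * Cp)) := by
    rw [hRHS, Finset.sum_div, Finset.mul_sum]
    refine Finset.sum_congr rfl fun S _ => ?_
    show wL S * (θ * (φ S / (x * Cp)) * (x - TL (j + 1))) = θ * (x - TL (j + 1)) * (wL S * φ S / (x * Cp))
    ring
  have e2 : ∑ S ∈ L.powerset, wL S * (TL (j + 1 - ∑ k ∈ S, a k) - x) =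
      (∑ S ∈ L.powerset, wL S * TL (j + 1 - ∑ k ∈ S, a k)) - x := by
    rw [Finset.sum_congr rfl fun S _ => mul_sub (wL S) _ _, Finset.sum_sub_distrib, ← Finset.sum_mul,
      sum_powerset_weight p L, one_mul]
  rw [e1, e2] at hsum
  -- `θ·RHS/(x Cp) = m₀ + slack`, and the empty outcome's deficit `m₀ (x − TL(j+1))` is covered
  have e3 : θ * (x - TL (j + 1)) * (RHS / (x * Cp)) = (x - TL (j + 1)) * (wL ∅ + (RHS - LHS) / 2 / (x * Cp)) := by
    have : θ * (RHS / (x * Cp)) = (θ * RHS) / (x * Cp) := by ring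
    rw [mul_comm θ, mul_assoc, this, hθRHS, hLHS]
    field_simp
  rw [e3] at hsum
  have hslack : 0 ≤ (x - TL (j + 1)) * ((RHS - LHS) / 2 / (x * Cp)) :=
    mul_nonneg (by linarith) (div_nonneg (by linarith) hxCp.le)
  have e4 : (x - TL (j + 1)) * (wL ∅ + (RHS - LHS) / 2 / (x * Cp)) - wL ∅ * (x - TL (j + 1)) =
      (x - TL (j + 1)) * ((RHS - LHS) / 2 / (x * Cp)) := by ring
  linarith

end IndepBlob

end Quant

end Summit.CriticalPhenomena.PercolationContinuityZ3.Theorems
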